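import Summits.AnomalousDissipation.AnomalousDissipation.Theorems.RestMeanFloorTG.Negative.SingleModeLaminarUnique
import Literature.Analysis.FluidPDE.TorusClassicalLerayHopfProofs
import Literature.Analysis.FluidPDE.LongTimeAveragePeriodic
import Literature.Analysis.FluidPDE.NavierStokesConcentrationTools
import Literature.Analysis.FunctionSpaces.TorusInverseLaplacianCalculus
import Literature.Analysis.FunctionSpaces.TorusTestFunction
import Literature.Analysis.FunctionSpaces.TorusWeightedGalerkinCoefficients

/-!
# Galilean-drifted single Stokes modes are exact steady Navier–Stokes flows (small-model facts
for the Kolmogorov-force cruxes; clause 1 of the aside `SymmetricOrLoud.DriftStatesAreLerayHopf`)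

Negative-lane file (small-model / non-vacuity witnesses; no Theses statement is asserted).
For a frequency `k`, a transversal polarisation `v` (`⟪k, v⟫ = 0`), a constant drift `W ∈ ℝ³` and
amplitudes `a, b`, the steady field `d(x) = W + a sin(2πk·x) v + b cos(2πk·x) v` satisfies
`(d·∇)d = 2πσ (a cos − b sin)(2πk·x) v` with `σ = ⟪k, W⟫` and `Δd = −λ (d − W)`, `λ = 4π²|k|²`;
hence it is a CLASSICAL STEADY SOLUTION on `ℝ × T³` with zero pressure and the single-mode force
`(νλa − 2πσb) sin(2πk·x) v + (νλb + 2πσa) cos(2πk·x) v` (`isClassicalNSSolutionOn_driftMode`), and a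
global Leray–Hopf solution from itself (`isGlobalLerayHopf_driftMode`, by
`Torus.IsClassicalNSSolutionOn.isGlobalLerayHopf`). Solving the 2×2 system for the Kolmogorov force
`sin(4πx₁)e₀ = stokesMode (0,2,0) e₀ sin` with drift `W = V e₁` (`σ = 2V`, `λ = 16π²`) gives
EXACTLY the drift states of `SymmetricOrLoud.DriftStatesAreLerayHopf` (item 28615):
`a = ν/(V² + 16π²ν²)`, `b = −V/(4π(V² + 16π²ν²))` — `isGlobalLerayHopf_kolmogorovDrift` is clause 1
of that aside verbatim (a prover closes it; the energy/dissipation clauses are not treated here).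
These are bounded-energy (`→ V² + 1/(32π²V²)`), quiet (dissipation `O(ν)`), planar, steady
Leray–Hopf states at every `ν > 0`: non-vacuity witnesses for the «bounded ∧ quiet ⇒ planar»
hypotheses of `ClassTrim.BoundedQuietPlanarity`, `SymmetricOrLoud.QuietTrajectories…`, which no
laminar state provides (laminar energy `∼ ν⁻²`).
-/

noncomputable section
-- the mandated namespace `Summit.<Summit>.<Problem>.Theorems` repeats `AnomalousDissipation` (single-problem summit)
set_option linter.dupNamespace false

namespace Summit.AnomalousDissipation.AnomalousDissipation.Theorems.DriftStatesAreLerayHopf.Negative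

open MeasureTheory Set Filter Topology UnitAddTorus
open scoped ENNReal NNReal InnerProductSpace ContDiff
open Literature.Analysis.FunctionSpaces Literature.Analysis.FunctionSpaces.Torus
open Literature.Analysis.FluidPDE Literature.Analysis.FluidPDE.Torus
open Summit.AnomalousDissipation.AnomalousDissipation.Theorems.RestMeanFloorTG.Negative (integral_norm_sq_ampMode)

variable {k : Fin 3 → ℤ} {v : EuclideanSpace ℝ (Fin 3)}

/-! ## 1. Calculus of constant fields and of single modes along a drifting field -/

/-- `(u·∇)W = 0` for a constant field `W`. [folklore] -/
theorem convect_constField (u : UnitAddTorus (Fin 3) → EuclideanSpace ℝ (Fin 3))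
    (W : EuclideanSpace ℝ (Fin 3)) (x : UnitAddTorus (Fin 3)) :
    Torus.convect u (fun _ : UnitAddTorus (Fin 3) => W) x = 0 := by
  have h : liftAt (fun _ : UnitAddTorus (Fin 3) => W) x = fun _ => W := by
    funext y; simp [liftAt_apply]
  simp [Torus.convect, Torus.fderiv, h]

/-- `ΔW = 0` for a constant field `W`. [folklore] -/
theorem laplacian_constField (W : EuclideanSpace ℝ (Fin 3)) (x : UnitAddTorus (Fin 3)) :
    Torus.laplacian (fun _ : UnitAddTorus (Fin 3) => W) x = 0 := by
  have h : liftAt (fun _ : UnitAddTorus (Fin 3) => W) x = fun _ => W := by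
    funext y; simp [liftAt_apply]
  rw [Torus.laplacian, h]
  exact congrFun (InnerProductSpace.laplacian_const (E := EuclideanSpace ℝ (Fin 3)) (c := W)) 0

/-- Smooth divergence-free fields are closed under addition. [folklore] -/
private theorem isDivFree_add' {u w : UnitAddTorus (Fin 3) → EuclideanSpace ℝ (Fin 3)}
    (hu : IsSmooth u) (hw : IsSmooth w) (hud : IsDivFree u) (hwd : IsDivFree w) :
    IsDivFree (u + w) := by
  intro x
  have hu1 : ∀ i, IsContDiff 1 (fun y => u y i) := fun i => (hu.apply i).isContDiff (by simp)
  have hw1 : ∀ i, IsContDiff 1 (fun y => w y i) := fun i => (hw.apply i).isContDiff (by simp)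
  have h : ∀ i, partialDeriv i (fun y => (u + w) y i) x =
      partialDeriv i (fun y => u y i) x + partialDeriv i (fun y => w y i) x := by
    intro i
    have e : (fun y => (u + w) y i) = (fun y => u y i) + fun y => w y i := by
      funext y; simp
    rw [e, partialDeriv_add (hu1 i) (hw1 i)]
    rfl
  unfold divergence
  simp_rw [h]
  rw [Finset.sum_add_distrib]
  have h0 := hud x
  have h1 := hwd x
  unfold divergence at h0 h1
  rw [h0, h1, add_zero]

/-- A constant field is the zero-frequency cosine mode: `stokesMode 0 W cos = W`. [folklore] -/
theorem stokesMode_zero_true (W : EuclideanSpace ℝ (Fin 3)) :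
    ⇑(stokesMode (0 : Fin 3 → ℤ) W true) = fun _ => W := by
  funext x
  rw [stokesMode_apply, if_pos rfl, mFourier_zero]
  simp

/-- **Convective derivative of a sine mode**: `(u·∇)(sin(2πk·x) v) = 2π⟪k, u(x)⟫ cos(2πk·x) v`. [folklore] -/
theorem convect_stokesMode_false (u : UnitAddTorus (Fin 3) → EuclideanSpace ℝ (Fin 3)) (k : Fin 3 → ℤ)
    (v : EuclideanSpace ℝ (Fin 3)) (x : UnitAddTorus (Fin 3)) :
    Torus.convect u (stokesMode k v false) x = (2 * Real.pi * ⟪latticeVec k, u x⟫_ℝ) • stokesMode k v true x := by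
  rw [convect_stokesMode_apply, if_neg Bool.false_ne_true]
  have h : (fun _ : Fin 3 → ℤ => (2 * (Real.pi : ℂ) * Complex.I) •
      ((-Complex.I) • EuclideanSpace.complexify v)) =
      (2 * Real.pi) • (fun _ : Fin 3 → ℤ => (if true then (1 : ℂ) else -Complex.I) • EuclideanSpace.complexify v) := by
    funext _
    rw [Pi.smul_apply, if_pos rfl, one_smul, smul_smul, ← Complex.coe_smul]
    congr 1
    rw [mul_neg, mul_assoc, Complex.I_mul_I]
    push_cast
    ring
  rw [h, realTrigPoly_smul, Pi.smul_apply, ← stokesMode_eq_realTrigPoly, smul_smul, mul_comm]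

/-- **Convective derivative of a cosine mode**: `(u·∇)(cos(2πk·x) v) = −2π⟪k, u(x)⟫ sin(2πk·x) v`. [folklore] -/
theorem convect_stokesMode_true (u : UnitAddTorus (Fin 3) → EuclideanSpace ℝ (Fin 3)) (k : Fin 3 → ℤ)
    (v : EuclideanSpace ℝ (Fin 3)) (x : UnitAddTorus (Fin 3)) :
    Torus.convect u (stokesMode k v true) x = (-(2 * Real.pi * ⟪latticeVec k, u x⟫_ℝ)) • stokesMode k v false x := by
  rw [convect_stokesMode_apply, if_pos rfl]
  have h : (fun _ : Fin 3 → ℤ => (2 * (Real.pi : ℂ) * Complex.I) •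
      ((1 : ℂ) • EuclideanSpace.complexify v)) =
      (-(2 * Real.pi)) • (fun _ : Fin 3 → ℤ => (if false then (1 : ℂ) else -Complex.I) • EuclideanSpace.complexify v) := by
    funext _
    rw [Pi.smul_apply, if_neg Bool.false_ne_true, one_smul, ← Complex.coe_smul, smul_smul]
    congr 1
    push_cast
    ring
  rw [h, realTrigPoly_smul, Pi.smul_apply, ← stokesMode_eq_realTrigPoly, smul_smul]
  congr 1
  ring

/-- Along the drifted field `d = W + a sin v + b cos v` the `k`-component is the constant `⟪k, W⟫`
(`⟪k, v⟫ = 0`). [folklore] -/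
theorem inner_latticeVec_driftMode (hkv : ⟪latticeVec k, v⟫_ℝ = 0) (W : EuclideanSpace ℝ (Fin 3)) (a b : ℝ)
    (x : UnitAddTorus (Fin 3)) :
    ⟪latticeVec k, W + a • stokesMode k v false x + b • stokesMode k v true x⟫_ℝ = ⟪latticeVec k, W⟫_ℝ := by
  rw [inner_add_right, inner_add_right, stokesMode_apply, stokesMode_apply]
  simp only [inner_smul_right, hkv, mul_zero, add_zero]

/-! ## 2. Drifted single modes are classical steady solutions -/

/-- The drifted field is smooth. [folklore] -/
theorem isSmooth_driftMode (k : Fin 3 → ℤ) (v W : EuclideanSpace ℝ (Fin 3)) (a b : ℝ) :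
    IsSmooth (fun x : UnitAddTorus (Fin 3) => W + a • stokesMode k v false x + b • stokesMode k v true x) := by
  have h : (fun x : UnitAddTorus (Fin 3) => W + a • stokesMode k v false x + b • stokesMode k v true x) =
      (fun _ => W) + a • ⇑(stokesMode k v false) + b • ⇑(stokesMode k v true) := by
    funext x; simp
  rw [h]
  exact ((isSmooth_const W).add ((isSmooth_stokesMode k v false).smul a)).add
    ((isSmooth_stokesMode k v true).smul b)

/-- The drifted field is divergence free (`⟪k, v⟫ = 0`). [folklore] -/
theorem isDivFree_driftMode (hkv : ⟪latticeVec k, v⟫_ℝ = 0) (W : EuclideanSpace ℝ (Fin 3)) (a b : ℝ) :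
    IsDivFree (fun x : UnitAddTorus (Fin 3) => W + a • stokesMode k v false x + b • stokesMode k v true x) := by
  have h : (fun x : UnitAddTorus (Fin 3) => W + a • stokesMode k v false x + b • stokesMode k v true x) =
      ⇑(stokesMode (0 : Fin 3 → ℤ) W true) + ⇑(stokesMode k (a • v) false) + ⇑(stokesMode k (b • v) true) := by
    funext x
    simp only [Pi.add_apply, stokesMode_zero_true, stokesMode_smul, ContinuousMap.smul_apply]
  rw [h]
  have hav : ⟪latticeVec k, a • v⟫_ℝ = 0 := by rw [inner_smul_right, hkv, mul_zero]
  have hbv : ⟪latticeVec k, b • v⟫_ℝ = 0 := by rw [inner_smul_right, hkv, mul_zero]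
  exact isDivFree_add' ((isSmooth_stokesMode 0 W true).add (isSmooth_stokesMode k _ false))
    (isSmooth_stokesMode k _ true)
    (isDivFree_add' (isSmooth_stokesMode 0 W true) (isSmooth_stokesMode k _ false)
      (isDivFree_stokesMode (by simp) true) (isDivFree_stokesMode hav false))
    (isDivFree_stokesMode hbv true)

/-- `(d·∇)d = 2π⟪k,W⟫ (a cos v − b sin v)` for the drifted field. [folklore] -/
theorem convect_driftMode_self (hkv : ⟪latticeVec k, v⟫_ℝ = 0) (W : EuclideanSpace ℝ (Fin 3)) (a b : ℝ)
    (x : UnitAddTorus (Fin 3)) :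
    Torus.convect (fun y : UnitAddTorus (Fin 3) => W + a • stokesMode k v false y + b • stokesMode k v true y)
      (fun y : UnitAddTorus (Fin 3) => W + a • stokesMode k v false y + b • stokesMode k v true y) x =
      (2 * Real.pi * ⟪latticeVec k, W⟫_ℝ * a) • stokesMode k v true x +
        (-(2 * Real.pi * ⟪latticeVec k, W⟫_ℝ * b)) • stokesMode k v false x := by
  have hS : IsContDiff 1 ⇑(stokesMode k v false) := (isSmooth_stokesMode k v false).isContDiff (by simp)
  have hC : IsContDiff 1 ⇑(stokesMode k v true) := (isSmooth_stokesMode k v true).isContDiff (by simp)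
  have hW : IsContDiff 1 (fun _ : UnitAddTorus (Fin 3) => W) := (isSmooth_const W).isContDiff (by simp)
  have haS : IsContDiff 1 (fun y : UnitAddTorus (Fin 3) => a • stokesMode k v false y) := hS.smul a
  have hbC : IsContDiff 1 (fun y : UnitAddTorus (Fin 3) => b • stokesMode k v true y) := hC.smul b
  have hWS : IsContDiff 1 (fun y : UnitAddTorus (Fin 3) => W + a • stokesMode k v false y) := hW.add haS
  rw [convect_add_right _ hWS hbC, convect_add_right _ hW haS,
    convect_constField, zero_add, convect_smul_right _ hS, convect_smul_right _ hC,
    convect_stokesMode_false, convect_stokesMode_true]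
  simp only [inner_latticeVec_driftMode hkv, smul_smul]
  module

/-- `Δd = −λ(a sin v + b cos v)`, `λ = stokesEigenvalue k`. [folklore] -/
theorem laplacian_driftMode (k : Fin 3 → ℤ) (v W : EuclideanSpace ℝ (Fin 3)) (a b : ℝ) (x : UnitAddTorus (Fin 3)) :
    Torus.laplacian (fun y : UnitAddTorus (Fin 3) => W + a • stokesMode k v false y + b • stokesMode k v true y) x =
      (-(stokesEigenvalue k * a)) • stokesMode k v false x + (-(stokesEigenvalue k * b)) • stokesMode k v true x := by
  have h : (fun y : UnitAddTorus (Fin 3) => W + a • stokesMode k v false y + b • stokesMode k v true y) =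
      (fun _ => W) + a • ⇑(stokesMode k v false) + b • ⇑(stokesMode k v true) := by
    funext y; simp
  rw [h, Literature.Analysis.FunctionSpaces.Torus.laplacian_add_apply ((isSmooth_const W).add ((isSmooth_stokesMode k v false).smul a))
      ((isSmooth_stokesMode k v true).smul b),
    Literature.Analysis.FunctionSpaces.Torus.laplacian_add_apply (isSmooth_const W) ((isSmooth_stokesMode k v false).smul a),
    laplacian_constField, zero_add,
    laplacian_const_smul_apply (isSmooth_stokesMode k v false),
    laplacian_const_smul_apply (isSmooth_stokesMode k v true),
    laplacian_stokesMode, laplacian_stokesMode, smul_smul, smul_smul]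
  module

/-- **Drifted single Stokes modes are classical steady NS solutions.** For `⟪k, v⟫ = 0`, any
drift `W`, amplitudes `a, b` and viscosity `ν`, the steady field `d = W + a sin(2πk·x)v + b cos(2πk·x)v`
solves the forced Navier–Stokes system on `ℝ × T³` classically with zero pressure and the single-mode
force `(νλa − 2πσb) sin v + (νλb + 2πσa) cos v`, `σ = ⟪k, W⟫`, `λ = 4π²|k|²`. [folklore] -/
theorem isClassicalNSSolutionOn_driftMode (hkv : ⟪latticeVec k, v⟫_ℝ = 0) (W : EuclideanSpace ℝ (Fin 3))
    (a b ν : ℝ) :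
    IsClassicalNSSolutionOn univ ν
      (fun _ (x : UnitAddTorus (Fin 3)) =>
        (ν * stokesEigenvalue k * a - 2 * Real.pi * ⟪latticeVec k, W⟫_ℝ * b) • stokesMode k v false x +
          (ν * stokesEigenvalue k * b + 2 * Real.pi * ⟪latticeVec k, W⟫_ℝ * a) • stokesMode k v true x)
      (fun _ (x : UnitAddTorus (Fin 3)) => W + a • stokesMode k v false x + b • stokesMode k v true x)
      (fun _ _ => (0 : ℝ)) where
  smooth_velocity := isSmoothSpaceTimeOn_const (isSmooth_driftMode k v W a b) _
  smooth_pressure := isSmoothSpaceTimeOn_const (isSmooth_const (0 : ℝ)) _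
  divFree _ _ := isDivFree_driftMode hkv W a b
  momentum t _ x := by
    have hg : Torus.gradient (fun _ : UnitAddTorus (Fin 3) => (0 : ℝ)) x = 0 :=
      gradient_fun_const (0 : EuclideanSpace ℝ (Fin 3)) (0 : ℝ)
    have ht : Literature.Analysis.FunctionSpaces.Torus.timeDerivWithin univ
        (fun _ (y : UnitAddTorus (Fin 3)) => W + a • stokesMode k v false y + b • stokesMode k v true y) t x = 0 := by
      unfold Literature.Analysis.FunctionSpaces.Torus.timeDerivWithin
      rw [derivWithin_univ, deriv_const]
    rw [ht, zero_add, convect_driftMode_self hkv, laplacian_driftMode, hg, sub_zero, smul_add, smul_smul, smul_smul]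
    module

/-- **… hence global Leray–Hopf solutions from themselves** (`Torus.IsClassicalNSSolutionOn.isGlobalLerayHopf`). [folklore] -/
theorem isGlobalLerayHopf_driftMode (hkv : ⟪latticeVec k, v⟫_ℝ = 0) (W : EuclideanSpace ℝ (Fin 3)) (a b ν : ℝ) :
    IsGlobalLerayHopf ν
      (fun _ (x : UnitAddTorus (Fin 3)) =>
        (ν * stokesEigenvalue k * a - 2 * Real.pi * ⟪latticeVec k, W⟫_ℝ * b) • stokesMode k v false x +
          (ν * stokesEigenvalue k * b + 2 * Real.pi * ⟪latticeVec k, W⟫_ℝ * a) • stokesMode k v true x)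
      (fun x : UnitAddTorus (Fin 3) => W + a • stokesMode k v false x + b • stokesMode k v true x)
      (fun _ (x : UnitAddTorus (Fin 3)) => W + a • stokesMode k v false x + b • stokesMode k v true x) :=
  (isClassicalNSSolutionOn_driftMode hkv W a b ν).isGlobalLerayHopf

/-! ## 3. The Kolmogorov drift states of `SymmetricOrLoud` (item 28615, clause 1) -/

/-- `stokesEigenvalue (0,2,0) = 16π²`. [folklore] -/
theorem stokesEigenvalue_kolmogorov : stokesEigenvalue (![0, 2, 0] : Fin 3 → ℤ) = 16 * Real.pi ^ 2 := by
  unfold stokesEigenvalue freqNormSq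
  simp [Fin.sum_univ_three]
  ring

/-- `⟪(0,2,0), V e₁⟫ = 2V`. [folklore] -/
theorem inner_latticeVec_kolmogorov_drift (V : ℝ) :
    ⟪latticeVec (![0, 2, 0] : Fin 3 → ℤ), V • EuclideanSpace.single (1 : Fin 3) (1 : ℝ)⟫_ℝ = 2 * V := by
  rw [inner_smul_right, EuclideanSpace.inner_single_right, latticeVec_apply]
  simp
  ring

/-- **The Kolmogorov drift states are global Leray–Hopf solutions** — clause 1 of the aside
`SymmetricOrLoud.DriftStatesAreLerayHopf` (28615), verbatim: for every drift `V` and every `ν > 0`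
the steady planar field `V e₁ + (ν/(V²+16π²ν²)) sin(4πx₁)e₀ − (V/(4π(V²+16π²ν²))) cos(4πx₁)e₀` is a
global Leray–Hopf solution with the Kolmogorov force `sin(4πx₁)e₀` and itself as datum. [folklore] -/
theorem isGlobalLerayHopf_kolmogorovDrift (V : ℝ) {ν : ℝ} (hν : 0 < ν) :
    IsGlobalLerayHopf ν
      (fun _ => ⇑(stokesMode (![0, 2, 0] : Fin 3 → ℤ) (EuclideanSpace.single (0 : Fin 3) (1 : ℝ)) false))
      (fun x : UnitAddTorus (Fin 3) => V • EuclideanSpace.single (1 : Fin 3) (1 : ℝ) +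
        (ν / (V ^ 2 + 16 * Real.pi ^ 2 * ν ^ 2)) •
          (stokesMode (![0, 2, 0] : Fin 3 → ℤ) (EuclideanSpace.single (0 : Fin 3) (1 : ℝ)) false x) +
        (-V / (4 * Real.pi * (V ^ 2 + 16 * Real.pi ^ 2 * ν ^ 2))) •
          (stokesMode (![0, 2, 0] : Fin 3 → ℤ) (EuclideanSpace.single (0 : Fin 3) (1 : ℝ)) true x))
      (fun _ : ℝ => fun x : UnitAddTorus (Fin 3) => V • EuclideanSpace.single (1 : Fin 3) (1 : ℝ) +
        (ν / (V ^ 2 + 16 * Real.pi ^ 2 * ν ^ 2)) •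
          (stokesMode (![0, 2, 0] : Fin 3 → ℤ) (EuclideanSpace.single (0 : Fin 3) (1 : ℝ)) false x) +
        (-V / (4 * Real.pi * (V ^ 2 + 16 * Real.pi ^ 2 * ν ^ 2))) •
          (stokesMode (![0, 2, 0] : Fin 3 → ℤ) (EuclideanSpace.single (0 : Fin 3) (1 : ℝ)) true x)) := by
  have hkv : ⟪latticeVec (![0, 2, 0] : Fin 3 → ℤ), EuclideanSpace.single (0 : Fin 3) (1 : ℝ)⟫_ℝ = 0 := by
    rw [EuclideanSpace.inner_single_right, latticeVec_apply]
    simp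
  have hD : V ^ 2 + 16 * Real.pi ^ 2 * ν ^ 2 ≠ 0 := by positivity
  have hπ : Real.pi ≠ 0 := Real.pi_ne_zero
  have h := isGlobalLerayHopf_driftMode hkv (V • EuclideanSpace.single (1 : Fin 3) (1 : ℝ))
    (ν / (V ^ 2 + 16 * Real.pi ^ 2 * ν ^ 2)) (-V / (4 * Real.pi * (V ^ 2 + 16 * Real.pi ^ 2 * ν ^ 2))) ν
  rw [stokesEigenvalue_kolmogorov, inner_latticeVec_kolmogorov_drift] at h
  have hs : ν * (16 * Real.pi ^ 2) * (ν / (V ^ 2 + 16 * Real.pi ^ 2 * ν ^ 2)) -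
      2 * Real.pi * (2 * V) * (-V / (4 * Real.pi * (V ^ 2 + 16 * Real.pi ^ 2 * ν ^ 2))) = 1 := by
    field_simp
    ring
  have hc : ν * (16 * Real.pi ^ 2) * (-V / (4 * Real.pi * (V ^ 2 + 16 * Real.pi ^ 2 * ν ^ 2))) +
      2 * Real.pi * (2 * V) * (ν / (V ^ 2 + 16 * Real.pi ^ 2 * ν ^ 2)) = 0 := by
    field_simp
    ring
  rw [hs, hc] at h
  simpa only [one_smul, zero_smul, add_zero] using h

/-! ## 4. Energy of a drifted mode (clause 2 of the aside) -/

/-- Same-frequency sine and cosine modes are `L²`-orthogonal (`∫ sin·cos = 0`). [folklore] -/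
theorem inner_stokesModeL2_false_true (hk : k ≠ 0) (a a' : EuclideanSpace ℝ (Fin 3)) :
    ⟪stokesModeL2 k a false, stokesModeL2 k a' true⟫_ℝ = 0 := by
  rw [inner_stokesModeL2_coe, mFourierCoeff_stokesModeL2_apply, if_pos (rfl : k = k),
    if_neg (self_ne_neg.mpr hk), EuclideanSpace.conjVec_zero, add_zero, inner_smul_right]
  simp [inner_smul_left, EuclideanSpace.inner_complexify]

/-- `∫ ⟪sin-mode, cos-mode⟫ = 0`. [folklore] -/
theorem integral_inner_stokesMode_false_true (hk : k ≠ 0) (a a' : EuclideanSpace ℝ (Fin 3)) :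
    ∫ x, ⟪stokesMode k a false x, stokesMode k a' true x⟫_ℝ = 0 := by
  rw [← inner_stokesModeL2_false_true hk a a', MeasureTheory.L2.inner_def]
  refine integral_congr_ae ?_
  filter_upwards [coeFn_stokesModeL2 k a false, coeFn_stokesModeL2 k a' true] with x h1 h2
  rw [h1, h2]

/-- **Energy of a drifted mode**: `∫ ‖W + a sin v + b cos v‖² = ‖W‖² + ½‖v‖²(a² + b²)`
(zero mean of the modes, `∫ sin² = ∫ cos² = ½`, `∫ sin·cos = 0`). [folklore] -/
theorem integral_norm_sq_driftMode (hk : k ≠ 0) (v W : EuclideanSpace ℝ (Fin 3)) (a b : ℝ) :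
    ∫ x, ‖W + a • stokesMode k v false x + b • stokesMode k v true x‖ ^ 2 =
      ‖W‖ ^ 2 + ‖v‖ ^ 2 / 2 * (a ^ 2 + b ^ 2) := by
  have hS := (stokesMode k v false).continuous
  have hC := (stokesMode k v true).continuous
  have hSa : Integrable (fun x : UnitAddTorus (Fin 3) => a • stokesMode k v false x) :=
    (hS.const_smul a).integrable_unitAddTorus
  have hCb : Integrable (fun x : UnitAddTorus (Fin 3) => b • stokesMode k v true x) :=
    (hC.const_smul b).integrable_unitAddTorus
  have hm : Integrable (fun x : UnitAddTorus (Fin 3) => a • stokesMode k v false x + b • stokesMode k v true x) :=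
    hSa.add hCb
  have h0 : Integrable (fun _ : UnitAddTorus (Fin 3) => ‖W‖ ^ 2) := integrable_const _
  have h1 : Integrable (fun x : UnitAddTorus (Fin 3) =>
      2 * ⟪W, a • stokesMode k v false x + b • stokesMode k v true x⟫_ℝ) :=
    (continuous_const.mul (continuous_const.inner ((hS.const_smul a).add (hC.const_smul b)))).integrable_unitAddTorus
  have h2 : Integrable (fun x : UnitAddTorus (Fin 3) => ‖a • stokesMode k v false x‖ ^ 2) :=
    (((hS.const_smul a).norm).pow 2).integrable_unitAddTorus
  have h3 : Integrable (fun x : UnitAddTorus (Fin 3) =>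
      2 * (a * b) * ⟪stokesMode k v false x, stokesMode k v true x⟫_ℝ) :=
    (continuous_const.mul (hS.inner hC)).integrable_unitAddTorus
  have h4 : Integrable (fun x : UnitAddTorus (Fin 3) => ‖b • stokesMode k v true x‖ ^ 2) :=
    (((hC.const_smul b).norm).pow 2).integrable_unitAddTorus
  have h01 : Integrable (fun x : UnitAddTorus (Fin 3) =>
      ‖W‖ ^ 2 + 2 * ⟪W, a • stokesMode k v false x + b • stokesMode k v true x⟫_ℝ) := h0.add h1
  have h23 : Integrable (fun x : UnitAddTorus (Fin 3) => ‖a • stokesMode k v false x‖ ^ 2 +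
      2 * (a * b) * ⟪stokesMode k v false x, stokesMode k v true x⟫_ℝ) := h2.add h3
  have h234 : Integrable (fun x : UnitAddTorus (Fin 3) => ‖a • stokesMode k v false x‖ ^ 2 +
      2 * (a * b) * ⟪stokesMode k v false x, stokesMode k v true x⟫_ℝ + ‖b • stokesMode k v true x‖ ^ 2) :=
    h23.add h4
  have hpt : ∀ x : UnitAddTorus (Fin 3), ‖W + a • stokesMode k v false x + b • stokesMode k v true x‖ ^ 2 =
      ‖W‖ ^ 2 + 2 * ⟪W, a • stokesMode k v false x + b • stokesMode k v true x⟫_ℝ +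
        (‖a • stokesMode k v false x‖ ^ 2 +
          2 * (a * b) * ⟪stokesMode k v false x, stokesMode k v true x⟫_ℝ +
          ‖b • stokesMode k v true x‖ ^ 2) := by
    intro x
    rw [add_assoc, norm_add_sq_real, norm_add_sq_real, real_inner_smul_left, real_inner_smul_right]
    ring
  have hmean : ∫ x : UnitAddTorus (Fin 3), (a • stokesMode k v false x + b • stokesMode k v true x) = 0 := by
    rw [integral_add hSa hCb, integral_smul, integral_smul]
    have hz := hasZeroMean_stokesMode hk v false
    have hz' := hasZeroMean_stokesMode hk v true
    unfold HasZeroMean at hz hz'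
    rw [hz, hz', smul_zero, smul_zero, add_zero]
  simp_rw [hpt]
  rw [integral_add h01 h234, integral_add h0 h1, integral_add h23 h4, integral_add h2 h3,
    integral_const_mul, integral_const_mul, integral_inner hm W, hmean,
    integral_inner_stokesMode_false_true hk, integral_norm_sq_ampMode hk, integral_norm_sq_ampMode hk]
  simp
  ring

/-- **Mean energy of the steady drifted mode** `= ‖W‖² + ½‖v‖²(a² + b²)`. [folklore] -/
theorem meanEnergy_driftMode (hk : k ≠ 0) (v W : EuclideanSpace ℝ (Fin 3)) (a b : ℝ) :
    meanEnergy (fun _ : ℝ => fun x : UnitAddTorus (Fin 3) =>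
        W + a • stokesMode k v false x + b • stokesMode k v true x) =
      ‖W‖ ^ 2 + ‖v‖ ^ 2 / 2 * (a ^ 2 + b ^ 2) := by
  rw [meanEnergy_eq_of_periodic (τ := 1) (fun _ => rfl) one_pos]
  simp [integral_norm_sq_driftMode hk]

/-- **Mean energy of the Kolmogorov drift states** — clause 2 of `SymmetricOrLoud.DriftStatesAreLerayHopf`
verbatim: `V² + 1/(32π²(V² + 16π²ν²))` (bounded as `ν → 0` for `V ≠ 0`, unlike the laminar
`1/(512π⁴ν²)`). [folklore] -/
theorem meanEnergy_kolmogorovDrift (V : ℝ) {ν : ℝ} (hν : 0 < ν) :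
    meanEnergy (fun _ : ℝ => fun x : UnitAddTorus (Fin 3) => V • EuclideanSpace.single (1 : Fin 3) (1 : ℝ) +
        (ν / (V ^ 2 + 16 * Real.pi ^ 2 * ν ^ 2)) •
          (stokesMode (![0, 2, 0] : Fin 3 → ℤ) (EuclideanSpace.single (0 : Fin 3) (1 : ℝ)) false x) +
        (-V / (4 * Real.pi * (V ^ 2 + 16 * Real.pi ^ 2 * ν ^ 2))) •
          (stokesMode (![0, 2, 0] : Fin 3 → ℤ) (EuclideanSpace.single (0 : Fin 3) (1 : ℝ)) true x)) =
      V ^ 2 + 1 / (32 * Real.pi ^ 2 * (V ^ 2 + 16 * Real.pi ^ 2 * ν ^ 2)) := by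
  have hk : (![0, 2, 0] : Fin 3 → ℤ) ≠ 0 := fun h => by simpa using congrFun h 1
  have hD : V ^ 2 + 16 * Real.pi ^ 2 * ν ^ 2 ≠ 0 := by positivity
  have hπ : Real.pi ≠ 0 := Real.pi_ne_zero
  rw [meanEnergy_driftMode hk]
  simp [norm_smul]
  field_simp
  ring

end Summit.AnomalousDissipation.AnomalousDissipation.Theorems.DriftStatesAreLerayHopf.Negative

end
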